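import Literature.Analysis.FluidPDE.FluidComputer.ThresholdLevelTableA5
import HarnessLib

/-!
# Kernel run of the A = 5 level-table checker, chunks 44 … 47 (steps 1100 … 1199) (bp3 gen 13, layer 4)

HONEST FRAMING: low prior, high value-of-information experiment on Tao's machine paradigm; NOT a
claim that NS blows up.

Four kernel evaluations (`decide +kernel`; no `native_decide`, no extra axioms) of the checker
`runSteps` (`ThresholdLevelCheck.lean`) on 25 steps of `ThresholdLevelTableA5.stepsT` at a time, from
the entry box `Bc i` towards the next chunk's first level, returning the entry box `Bc (i+1)`
(≈ 30 s of kernel time per chunk; same scheme as `ThresholdLevelTableRun0 … 7` for A = 2).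
-/

namespace Literature.Analysis.FluidPDE.FluidComputer

namespace ThresholdLevelTableA5

set_option maxHeartbeats 10000000 in
set_option maxRecDepth 200000 in
/-- Chunk 44 of the A = 5 table run (steps 1100 … 1124). [folklore] -/
theorem run44 : runSteps 60 12 3 GIt RbIt Bc44 chunk44 11013496332421022 = some Bc45 := by
  decide +kernel

set_option maxHeartbeats 10000000 in
set_option maxRecDepth 200000 in
/-- Chunk 45 of the A = 5 table run (steps 1125 … 1149). [folklore] -/
theorem run45 : runSteps 60 12 3 GIt RbIt Bc45 chunk45 12055749233242890 = some Bc46 := by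
  decide +kernel

set_option maxHeartbeats 10000000 in
set_option maxRecDepth 200000 in
/-- Chunk 46 of the A = 5 table run (steps 1150 … 1174). [folklore] -/
theorem run46 : runSteps 60 12 3 GIt RbIt Bc46 chunk46 13196634854908716 = some Bc47 := by
  decide +kernel

set_option maxHeartbeats 10000000 in
set_option maxRecDepth 200000 in
/-- Chunk 47 of the A = 5 table run (steps 1175 … 1199). [folklore] -/
theorem run47 : runSteps 60 12 3 GIt RbIt Bc47 chunk47 14445487221447988 = some Bc48 := by
  decide +kernel

end ThresholdLevelTableA5

end Literature.Analysis.FluidPDE.FluidComputer
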